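import Summits.ResolutionOfSingularities.ResolutionOfSingularities.Theorems.WildPurityWildSymbolPeriodicTransport
import Summits.ResolutionOfSingularities.ResolutionOfSingularities.Theorems.WildPurityWildSymbolArcPlaces
import HarnessLib

/-!
# `WildSymbol` (stmt-ResolutionOfSingularities-17133), line `birth` — the BASIN RING of a periodic tower
# and the first excluded class of basins

Support file for crux #2 of route `ResolutionOfSingularities/WildPurity`
(`Summit.ResolutionOfSingularities.ResolutionOfSingularities.Theses.WildPurity.WildSymbol`), line `birth`
(definitions `Theorems/WildPurityWildSymbolBirthDefs.lean`; transport
`Theorems/WildPurityWildSymbolPeriodicTransport.lean`; absorption at discrete places with perfect residue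
field `Theorems/WildPurityWildSymbolArcPlaces.lean`). Lead's calibration of the open stub
`stub_selfSimilarGerm` (registered sub-goal `not_selfSimilarGerm_with_discrete_perfect_basin`).

* `exists_basin` — for a periodic tower `(σ, O, S, α)` the BASIN `T = ⋃ₙ σⁿ(S) = {x | σ⁻ⁿ x ∈ S for some n}`
  is a valuation ring of `K` containing `O` (an overring of a valuation ring), it is `σ`-stable, and
  `(σ, T, S, α)` is again a periodic tower. So the line may always assume that `O` IS the basin (up to the
  centre bookkeeping of (D), which only sees the centre of `O` on `R`).
* `mem_Unr_of_discrete_perfect_basin` — if the basin `T` is a discrete valuation ring with perfect residue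
  field (every element a `p`-th power modulo `𝔪_T`), then `α ∈ Unr S`: by the transport `α ∉ Unr S` would
  give `α ∉ Unr T`, but `Unr T = ⊤` (`unr_eq_top_of_dvr_of_perfect_residue`).
* `not_selfSimilarGerm_with_discrete_perfect_basin` — CALIBRATION (negative lemma, line language): the
  germ stub `Sig.stub_selfSimilarGerm` with the extra hypothesis "the basin of `(σ, locAt R O)` is a DVR with
  perfect residue field" is FALSE. This covers (a) every self-similar germ at a CLOSED point whose basin is
  discrete (its residue field is a directed union of copies of the finite extension `κ(S)/k`, hence
  perfect — paper remark, the finiteness being Zariski's lemma), and (b) every basin along a transcendental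
  formal arc `K ↪ k((t))` (e.g. the invariant branch `y = Σ q^{-n(n+1)/2} xⁿ` of `(x,y) ↦ (x/q, qy/x − 1)`
  on `k(x,y)`, the first non-Abhyankar basin one writes down). A live germ therefore has a NON-discrete
  basin (rank-one case: `v ∘ σ = λ v` with `λ < 1`) or a discrete one with imperfect residue field.

No definition is declared; nothing concludes the crux positively.
-/

noncomputable section

-- single-problem summit: the doubled namespace component `ResolutionOfSingularities` is forced
set_option linter.dupNamespace false

namespace Summit.ResolutionOfSingularities.ResolutionOfSingularities.Theorems.WildSymbol.Birth

open Summit.ResolutionOfSingularities.ResolutionOfSingularities.Theses.WildPurity (WildSymbol)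

variable {K : Type} [Field K]

/-! ## The basin of a periodic tower -/

/-- The level sets `{x | σ⁻ⁿ x ∈ S}` of a chart step `σ⁻¹ S ⊆ S` exhaust a SUBRING of `K` (their
directed union). Existence form (no definition): a subring `B` with `x ∈ B ↔ ∃ n, σ⁻ⁿ x ∈ S`. [folklore] -/
theorem exists_basin_subring (σ : K ≃+* K) (S : Subring K) (h1 : ∀ x : K, x ∈ S → σ.symm x ∈ S) :
    ∃ B : Subring K, ∀ x : K, x ∈ B ↔ ∃ n : ℕ, σ.symm^[n] x ∈ S := by
  refine ⟨{ carrier := {x | ∃ n : ℕ, σ.symm^[n] x ∈ S}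
            mul_mem' := ?_, one_mem' := ⟨0, S.one_mem⟩, add_mem' := ?_,
            zero_mem' := ⟨0, S.zero_mem⟩, neg_mem' := ?_ }, fun x => Iff.rfl⟩
  · rintro x y ⟨n, hx⟩ ⟨m, hy⟩
    refine ⟨max n m, ?_⟩
    rw [iterate_map_mul]
    exact S.mul_mem (iterate_symm_mem_of_le σ h1 hx (le_max_left n m))
      (iterate_symm_mem_of_le σ h1 hy (le_max_right n m))
  · rintro x y ⟨n, hx⟩ ⟨m, hy⟩
    refine ⟨max n m, ?_⟩
    rw [iterate_map_add]
    exact S.add_mem (iterate_symm_mem_of_le σ h1 hx (le_max_left n m))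
      (iterate_symm_mem_of_le σ h1 hy (le_max_right n m))
  · rintro x ⟨n, hx⟩
    exact ⟨n, by rw [iterate_map_neg]; exact S.neg_mem hx⟩

/-- **The basin ring.** For a periodic tower `(σ, O, S, α)` there is a valuation ring `T ⊇ O` of `K`
with `x ∈ T ↔ σ⁻ⁿ x ∈ S for some n` (i.e. `T = ⋃ₙ σⁿ(S)`), `T` is `σ`-stable, and `(σ, T, S, α)` is again
a periodic tower. [folklore] -/
theorem exists_basin (p : ℕ) (σ : K ≃+* K) (O : ValuationSubring K) (S : Subring K) (α : G K ⧸ N p K)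
    (hT : PeriodicTower p K σ O S α) :
    ∃ T : ValuationSubring K, O ≤ T ∧ (∀ x : K, x ∈ T ↔ ∃ n : ℕ, σ.symm^[n] x ∈ S) ∧
      (∀ x : K, x ∈ T ↔ σ x ∈ T) ∧ PeriodicTower p K σ T S α := by
  obtain ⟨h1, h2, h3⟩ := hT
  obtain ⟨B, hB⟩ := exists_basin_subring σ S h1
  have hOB : O.toSubring ≤ B := fun x hx => (hB x).mpr (exists_iterate_symm_mem σ (h2 x hx))
  refine ⟨ValuationSubring.ofLE O B hOB, fun x hx => hOB hx, fun x => hB x, fun x => ?_, h1, ?_, h3⟩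
  · show x ∈ B ↔ σ x ∈ B
    rw [hB, hB]
    constructor
    · rintro ⟨n, hn⟩
      exact ⟨n + 1, by rw [Function.iterate_succ_apply, RingEquiv.symm_apply_apply]; exact hn⟩
    · rintro ⟨n, hn⟩
      have h := iterate_symm_mem_of_le σ h1 hn (Nat.le_succ n)
      rw [Function.iterate_succ_apply, RingEquiv.symm_apply_apply] at h
      exact ⟨n, h⟩
  · intro x hx
    obtain ⟨n, hn⟩ := (hB x).mp hx
    refine ⟨n, σ.symm^[n] x, hn, ?_⟩
    have hl : Function.LeftInverse σ σ.symm := σ.apply_symm_apply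
    exact (hl.iterate n x).symm

/-! ## Basins that absorb: discrete with perfect residue field -/

/-- **If the basin is a DVR with perfect residue field, the bottom class is integral.** For a periodic
tower `(σ, O, S, α)` and a valuation ring `T` with `x ∈ T ↔ σ⁻ⁿ x ∈ S for some n` (the basin): if `T` is a
discrete valuation ring in which every element is a `p`-th power modulo `𝔪_T`, then `α ∈ Unr S`. Indeed
`(σ, T, S, α)` is a periodic tower, so `α ∉ Unr S` would transport to `α ∉ Unr T`
(`stub_periodicTransport`), while `Unr T = ⊤` (`unr_eq_top_of_dvr_of_perfect_residue`). [folklore] -/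
theorem mem_Unr_of_discrete_perfect_basin {p : ℕ} (hp : p.Prime) [CharP K p] (σ : K ≃+* K)
    (O T : ValuationSubring K) (S : Subring K) (α : G K ⧸ N p K) (hT : PeriodicTower p K σ O S α)
    (hbasin : ∀ x : K, x ∈ T ↔ ∃ n : ℕ, σ.symm^[n] x ∈ S) (hdvr : IsDiscreteValuationRing T)
    (hperf : ∀ u : K, u ∈ T → ∃ e : K, u - e ^ p ∈ T.nonunits) : α ∈ Unr p K S := by
  obtain ⟨h1, -, h3⟩ := hT
  have hTT : PeriodicTower p K σ T S α := by
    refine ⟨h1, fun x hx => ?_, h3⟩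
    obtain ⟨n, hn⟩ := (hbasin x).mp hx
    refine ⟨n, σ.symm^[n] x, hn, ?_⟩
    have hl : Function.LeftInverse σ σ.symm := σ.apply_symm_apply
    exact (hl.iterate n x).symm
  by_contra hS
  have h := stub_periodicTransport p K σ T S α hTT hS
  rw [unr_eq_top_of_dvr_of_perfect_residue hp T hdvr hperf] at h
  exact h trivial

/-- **CALIBRATION (negative lemma, line language): no self-similar germ with a discrete basin of perfect
residue field.** The germ stub `Sig.stub_selfSimilarGerm` (a periodic tower over the local ring
`locAt R O` of the point, (D), and `α ∉ Unr(locAt R O)`) together with "the basin `⋃ₙ σⁿ(locAt R O)` is a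
DVR in which every element is a `p`-th power modulo the maximal ideal" is FALSE. Covers every germ at a
closed point with discrete basin (residue field = directed union of the finite extensions `κ(σⁿ S)/k`,
perfect) and every basin along a transcendental formal arc. [folklore] -/
theorem not_selfSimilarGerm_with_discrete_perfect_basin :
    ¬ ∃ p : ℕ, p.Prime ∧ ∃ (k K : Type) (_ : Field k) (_ : CharP k p) (_ : PerfectField k) (_ : Field K)
      (_ : Algebra k K), (⊤ : IntermediateField k K).FG ∧ ∃ O : ValuationSubring K,
      (∀ c : k, algebraMap k K c ∈ O) ∧ ∃ R : Subalgebra k K, R.FG ∧ R.toSubring ≤ O.toSubring ∧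
      IsFractionRing R K ∧ ∃ (σ : K ≃+* K) (α : G K ⧸ N p K),
      PeriodicTower p K σ O (locAt (R : Set K) O) α ∧ DivIntegral p k K R O α ∧
      α ∉ Unr p K (locAt (R : Set K) O) ∧
      ∃ T : ValuationSubring K, (∀ x : K, x ∈ T ↔ ∃ n : ℕ, σ.symm^[n] x ∈ locAt (R : Set K) O) ∧
      IsDiscreteValuationRing T ∧ ∀ u : K, u ∈ T → ∃ e : K, u - e ^ p ∈ T.nonunits := by
  rintro ⟨p, hp, k, K, _, _, _, _, _, -, O, -, R, -, -, -, σ, α, hT, -, hloc, T, hbasin, hdvr, hperf⟩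
  haveI : CharP K p := charP_of_injective_algebraMap (algebraMap k K).injective p
  exact hloc (mem_Unr_of_discrete_perfect_basin hp σ O T _ α hT hbasin hdvr hperf)

end Summit.ResolutionOfSingularities.ResolutionOfSingularities.Theorems.WildSymbol.Birth

end
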